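import Summits.CriticalPhenomena.PercolationContinuityZ3.Theorems.PercNearOneGluingNoHeavyLowerTailSahiHalfCoSingletonChains
import Mathlib.Tactic.Linarith
import Mathlib.Tactic.Ring
import HarnessLib

/-!
# `NoHeavyLowerTail` (stmt-CriticalPhenomena-4575) — the half-co-singleton bound holds whenever TWO OF THE THREE SLOTS COINCIDE

Support file, seat `prim-l12-p5` (gen 2), `--supports stmt-CriticalPhenomena-4575`; uses the plumbing of `…SahiHalfCoSingletonChains`.
No definitions, no named facts, no sorries.

**`coSingletonSum_le_two_mul_sahiE_of_two_equal`**: for `q ∈ [0,1]^ι`, monotone `{0,1}`-valued `f, g` on `ι → Bool` (NO nesting assumed) and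
every coordinate `j`:  `coSingletonSum q ![f,f,g] j ≤ 2 · E₃(f,f,g)`, i.e. the half-co-singleton bound HC (tree `HalfCoSingletonBound`,
P5-REPORT §3h(o)) holds on every triple with two equal slots — a class containing the diagonal, both nested families of
`…SahiHalfCoSingletonChains{,B}` and the configurations where the constant `2` is sharp.  (`E₃` is symmetric in its slots, so the
statement covers any position of the repeated function up to relabelling; only the displayed order is formalised here.)

Proof.  With `s = q_j`, `a = E f`, `b = E g`, `c = E(fg)`: `E₃(f,f,g) = (1−a)(2c − ab)`; the joint-pivotality integrand is
`π_f·[(2−s)π_g + g(lo)] ≤ (2−s)·(fg)(hi)·(1 − f(lo))` pointwise; Harris on the co-singleton cube (`sum_hi_mul_one_sub_lo_le` with the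
increasing `fg` and the decreasing `1 − f`) and the slice bounds give `s(1−s)J ≤ (2−s)·c·(1−a)`; finally `(2−s)c ≤ 4c − 2ab`
because `ab ≤ c` (Harris on the whole cube, `ex_mul_ex_le_ex_mul` for the product weight).
-/

namespace Summit.CriticalPhenomena.PercolationContinuityZ3.Theorems

namespace SahiCoSingleton

open Finset Literature.Combinatorics.Sahi2008 SahiSubsetChord

variable {ι : Type*} [Fintype ι] [DecidableEq ι]

set_option maxHeartbeats 400000 in
/-- **HC whenever two slots coincide**: for monotone `{0,1}`-valued `f, g`, every product weight and every coordinate `j`,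
`E[E₃ of the one-coin sections of (f,f,g) at j] ≤ 2·E₃(f,f,g)`. [this file] -/
theorem coSingletonSum_le_two_mul_sahiE_of_two_equal (q : ι → ℝ) (hq : ∀ i, 0 ≤ q i ∧ q i ≤ 1) (f g : (ι → Bool) → ℝ)
    (hf01 : ∀ x, f x = 0 ∨ f x = 1) (hg01 : ∀ x, g x = 0 ∨ g x = 1) (hfm : Monotone f) (hgm : Monotone g) (j : ι) :
    coSingletonSum q ![f, f, g] j ≤ 2 * sahiE (prodWeight q) 3 ![f, f, g] := by
  have hind : ∀ a x, (![f, f, g] : Fin 3 → (ι → Bool) → ℝ) a x = 0 ∨ (![f, f, g] : Fin 3 → (ι → Bool) → ℝ) a x = 1 := by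
    intro a x; fin_cases a
    · exact hf01 x
    · exact hf01 x
    · exact hg01 x
  have hmono : ∀ a, Monotone ((![f, f, g] : Fin 3 → (ι → Bool) → ℝ) a) := by
    intro a; fin_cases a
    · exact hfm
    · exact hfm
    · exact hgm
  have hf0 : ∀ x, 0 ≤ f x := fun x => by rcases hf01 x with e | e <;> simp [e]
  have hf1 : ∀ x, f x ≤ 1 := fun x => by rcases hf01 x with e | e <;> simp [e]
  have hg0 : ∀ x, 0 ≤ g x := fun x => by rcases hg01 x with e | e <;> simp [e]
  have hg1 : ∀ x, g x ≤ 1 := fun x => by rcases hg01 x with e | e <;> simp [e]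
  set s := q j with hs
  have hs0 : 0 ≤ s := (hq j).1
  have hs1 : s ≤ 1 := (hq j).2
  set w : ({i // i ∈ (univ : Finset ι).erase j} → Bool) → ℝ :=
    prodWeight (fun i : {i // i ∈ (univ : Finset ι).erase j} => q i) with hw
  have hw0 : ∀ v, 0 ≤ w v := fun v =>
    prodWeight_nonneg (q := fun i : {i // i ∈ (univ : Finset ι).erase j} => q i) (fun i => hq i) v
  -- (1) E₃(f,f,g) = 2c + a²b − 2ac − ab, a = E f, b = E g, c = E(fg)
  set a := ex (prodWeight q) f with ha
  set b := ex (prodWeight q) g with hb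
  set c := ex (prodWeight q) (f * g) with hc
  have hff : f * f = f := by
    funext x; simp only [Pi.mul_apply]
    rcases hf01 x with e | e <;> rw [e] <;> ring
  have hE3 : sahiE (prodWeight q) 3 ![f, f, g] = 2 * c + a ^ 2 * b - 2 * a * c - a * b := by
    rw [sahiE_three_apply]
    simp only [Matrix.cons_val_zero, Matrix.cons_val_one, Matrix.head_cons, Matrix.cons_val_two, Matrix.tail_cons,
      hff]
    ring
  have hsum : ∑ x, prodWeight q x = 1 := sum_coinWeight q
  have ha0 : 0 ≤ a := ex_nonneg (fun x => prodWeight_nonneg hq x) hf0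
  have ha1 : a ≤ 1 := by
    have := ex_mono (μ := prodWeight q) (fun x => prodWeight_nonneg hq x) hf1
    rwa [ex_const hsum] at this
  have hfg0 : ∀ x, 0 ≤ (f * g) x := fun x => mul_nonneg (hf0 x) (hg0 x)
  have hfgm : Monotone (f * g) := fun x y hxy => mul_le_mul (hfm hxy) (hgm hxy) (hg0 x) (hf0 y)
  have hc0 : 0 ≤ c := ex_nonneg (fun x => prodWeight_nonneg hq x) hfg0
  -- Harris on the whole cube: a·b ≤ c
  have hFKG : IsFKGMeasure (prodWeight q) := isFKGMeasure_coinWeight hq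
  have hHarris : a * b ≤ c := ex_mul_ex_le_ex_mul hFKG hf0 hg0 hfm hgm
  -- (2) Z = s(1−s)·J and the pointwise bound J-integrand ≤ (2−s)·(fg)(hi)·(1 − f(lo))
  rw [coSingletonSum_eq q _ hind hmono j]
  have hJ : jointPivotality q ![f, f, g] j ≤ (2 - s) * ∑ v, w v * ((f * g) (hi j v) * (1 - f (lo j v))) := by
    unfold jointPivotality
    rw [Finset.mul_sum]
    refine Finset.sum_le_sum fun v _ => ?_
    simp only [Matrix.cons_val_zero, Matrix.cons_val_one, Matrix.head_cons, Matrix.cons_val_two, Matrix.tail_cons,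
      Pi.mul_apply]
    have hw0v := hw0 v
    have hlohi : lo j v ≤ hi j v := by
      intro i; unfold lo hi glue; split_ifs
      · exact le_rfl
      · exact Bool.false_le _
    have m_f : f (lo j v) ≤ f (hi j v) := hfm hlohi
    have m_g : g (lo j v) ≤ g (hi j v) := hgm hlohi
    have h2s : 0 ≤ 2 - s := by linarith
    rcases hf01 (lo j v) with f0 | f0 <;> rcases hf01 (hi j v) with f1 | f1 <;>
      rcases hg01 (lo j v) with g0 | g0 <;> rcases hg01 (hi j v) with g1 | g1 <;>
      simp only [f0, f1, g0, g1] at m_f m_g ⊢ <;>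
      nlinarith [hw0v, h2s, hs1]
  -- (3) Harris on the co-singleton cube, (4) slices
  have hH := sum_hi_mul_one_sub_lo_le q hq (f * g) f hfg0 hf0 hfgm hfm j
  have hA : s * ∑ v, w v * (f * g) (hi j v) ≤ c := mul_sum_hi_le_ex q hq (f * g) hfg0 j
  have hB : (1 - s) * ∑ v, w v * (1 - f (lo j v)) ≤ 1 - a := by
    have := mul_sum_lo_le_ex q hq (fun x => 1 - f x) (fun x => by linarith [hf1 x]) j
    have e : ex (prodWeight q) (fun x => 1 - f x) = 1 - a := by
      unfold ex
      rw [show (1 : ℝ) - a = ∑ x, prodWeight q x - ∑ x, prodWeight q x * f x by rw [hsum]; rfl,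
        ← Finset.sum_sub_distrib]
      refine Finset.sum_congr rfl fun x _ => ?_; ring
    rw [e] at this; exact this
  have hY0 : 0 ≤ ∑ v, w v * (1 - f (lo j v)) :=
    Finset.sum_nonneg fun v _ => mul_nonneg (hw0 v) (by linarith [hf1 (lo j v)])
  have hJ0 : 0 ≤ ∑ v, w v * ((f * g) (hi j v) * (1 - f (lo j v))) :=
    Finset.sum_nonneg fun v _ => mul_nonneg (hw0 v) (mul_nonneg (hfg0 _) (by linarith [hf1 (lo j v)]))
  -- (5) assemble: s(1−s)J ≤ (2−s)·c·(1−a) ≤ 2(1−a)(2c − ab) = 2E₃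
  rw [hE3]
  have hss : 0 ≤ s * (1 - s) := mul_nonneg hs0 (by linarith)
  have h2s : 0 ≤ 2 - s := by linarith
  have step1 : s * (1 - s) * jointPivotality q ![f, f, g] j
      ≤ s * (1 - s) * ((2 - s) * ∑ v, w v * ((f * g) (hi j v) * (1 - f (lo j v)))) :=
    mul_le_mul_of_nonneg_left hJ hss
  have step2 : s * (1 - s) * ((2 - s) * ∑ v, w v * ((f * g) (hi j v) * (1 - f (lo j v))))
      ≤ (2 - s) * ((s * ∑ v, w v * (f * g) (hi j v)) * ((1 - s) * ∑ v, w v * (1 - f (lo j v)))) := by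
    have := mul_le_mul_of_nonneg_left hH hss
    nlinarith [this, h2s, hss, hJ0]
  have step3 : (s * ∑ v, w v * (f * g) (hi j v)) * ((1 - s) * ∑ v, w v * (1 - f (lo j v))) ≤ c * (1 - a) :=
    mul_le_mul hA hB (mul_nonneg (by linarith) hY0) hc0
  have ha1' : 0 ≤ 1 - a := by linarith
  have step4 : (2 - s) * (c * (1 - a)) ≤ 2 * (2 * c + a ^ 2 * b - 2 * a * c - a * b) := by
    have hsc : 0 ≤ s * c := mul_nonneg hs0 hc0
    have hlin : (2 - s) * c ≤ 4 * c - 2 * (a * b) := by linarith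
    have hmul := mul_le_mul_of_nonneg_left hlin ha1'
    have e1 : (2 - s) * (c * (1 - a)) = (1 - a) * ((2 - s) * c) := by ring
    have e2 : 2 * (2 * c + a ^ 2 * b - 2 * a * c - a * b) = (1 - a) * (4 * c - 2 * (a * b)) := by ring
    rw [e1, e2]; exact hmul
  calc s * (1 - s) * jointPivotality q ![f, f, g] j
      ≤ s * (1 - s) * ((2 - s) * ∑ v, w v * ((f * g) (hi j v) * (1 - f (lo j v)))) := step1
    _ ≤ (2 - s) * ((s * ∑ v, w v * (f * g) (hi j v)) * ((1 - s) * ∑ v, w v * (1 - f (lo j v)))) := step2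
    _ ≤ (2 - s) * (c * (1 - a)) := mul_le_mul_of_nonneg_left step3 h2s
    _ ≤ 2 * (2 * c + a ^ 2 * b - 2 * a * c - a * b) := step4

end SahiCoSingleton

end Summit.CriticalPhenomena.PercolationContinuityZ3.Theorems
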